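import Literature.NumberTheory.QuadraticFields.BinaryQuadraticFormsClassNumberCountChunks
import HarnessLib

/-!
# Class number of `D = −96 295 483` by row chunks, file F4 of 4: rows `(4906, 5171] ↦ 22`, `(5171, 5424] ↦ 10`, `(5424, 5665] ↦ 2`

Topic `NumberTheory/QuadraticFields`, namespace `Literature.NumberTheory.QuadraticFields.Quadratic`; pure VALUES file (theorems only). The landau-siegel
rescue bed's deep negative ladder rung `D_73^− = D_79^− = −96 295 483` (prime; Lehmer–Lehmer–Shanks 1970) has
`h = 665` (engines A ≡ B of record). Its kernel evaluation by Cohen's Algorithm 5.3.5 (`BinQF.classNumberCount`,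
`BinaryQuadraticFormsClassNumberCount.lean`) needs ≈ 12 min of kernel time, beyond one declaration's budget (≈ 150 s) and one
file's (≈ 600 s), so the row range `1 ≤ a ≤ 5665` is cut into 12 chunks of roughly equal work (`BinQF.redRowsSumFrom`,
`BinaryQuadraticFormsClassNumberCountChunks.lean`), three per file; the assembly `BinQF.classNumber (−96295483) = 665` by
`BinQF.redRowsSumFrom_add` is in `ImaginaryQuadraticClassNumbersDeepI.lean`.

## References

* [Cohen1993] H. Cohen, *A Course in Computational Algebraic Number Theory*, GTM 138, §5.3.1 Algorithm 5.3.5.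
* [LehmerLehmerShanks1970] D. H. Lehmer, E. Lehmer, D. Shanks, Math. Comp. 24 (1970) 433–451, §1 and Table.
-/

namespace Literature.NumberTheory.QuadraticFields.Quadratic

/-- Row chunk `a ∈ (4906, 5171]` of Cohen's Algorithm 5.3.5 at `N = 96 295 483`: partial count `22` (one kernel evaluation).
[cite: Cohen1993, §5.3.1 Algorithm 5.3.5] -/
theorem redRowsSumFrom_96295483_4906 : BinQF.redRowsSumFrom 96295483 4906 265 = 22 := by
  decide +kernel

/-- Row chunk `a ∈ (5171, 5424]` of Cohen's Algorithm 5.3.5 at `N = 96 295 483`: partial count `10` (one kernel evaluation).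
[cite: Cohen1993, §5.3.1 Algorithm 5.3.5] -/
theorem redRowsSumFrom_96295483_5171 : BinQF.redRowsSumFrom 96295483 5171 253 = 10 := by
  decide +kernel

/-- Row chunk `a ∈ (5424, 5665]` of Cohen's Algorithm 5.3.5 at `N = 96 295 483`: partial count `2` (one kernel evaluation).
[cite: Cohen1993, §5.3.1 Algorithm 5.3.5] -/
theorem redRowsSumFrom_96295483_5424 : BinQF.redRowsSumFrom 96295483 5424 241 = 2 := by
  decide +kernel

end Literature.NumberTheory.QuadraticFields.Quadratic
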